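import Summits.ResolutionOfSingularities.ResolutionOfSingularities.Theorems.PurelyInseparableDim4AtlasMemberDefsTwo
import HarnessLib

/-!
# Purely inseparable four-folds: ATLAS MEMBERS, the tranche-1 induction datum `MemberDataAT` (brick S3 (c) v4, tranche 1, definitions
# part 3; cell `res-dim4-pi`)

[OURS · counted 0] (D-0157 DOOR 2; host item stmt-ResolutionOfSingularities-16155, helper). Nothing here proves resolution of
singularities in dimension ≥ 4 / characteristic `p`. NO theorem content. Design erratum E-V4-1 (typ-3 g7, cell STATUS 2026-08-29
11:14Z): the last clause of `MemberDataA` (p711312) / `MemberDataAF` (p713131), the model-free invariant «every boundary component meeting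
the member CONTAINS it», is FALSE for escaping children below depth 1 (the parent's own exceptional component `V(x_m)` meets an escaping
child `B × ℙ(L)` in `B × (hyperplane of the fibre)` whenever `m ∉ S‴ ∖ {k}`) and is not used anywhere in tranche 1 (no waiting regions). The
induction datum of the chain A2–A5 is therefore `MemberDataAF` WITHOUT that clause, and WITH the format invariant of generated readings
(`res-dim4-typ-3/S3c-V4-ATLAS-MEMBERS-DESIGN.md` §9 (I2)): every deferred index of a reading is one of its bundle directions, and no bundle
direction is a centre variable (`indices(X) ⊆ D`, `D ∩ T = ∅`) — what the child package A1 (`atlas_child_package`) consumes as `hXd`/`hDd`.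

* `MemberDataAT`. AI-produced formalisation, weaker than expert review.
bears_on: LADDER-RESOLUTION:D157-DOOR2 (res-dim4-pi · S3 (c) v4 atlas members · defs 3).
-/

set_option linter.dupNamespace false -- D-0017: single-problem summit path `Summit.<S>.<S>.…` by design

noncomputable section

open MvPolynomial Finset CategoryTheory AlgebraicGeometry Opposite TopologicalSpace
open AlgebraicGeometry.Scheme.IdealSheafData (ofIdealTop vanishingIdeal)

namespace Summit.ResolutionOfSingularities.ResolutionOfSingularities.Theorems.PIDim4

open Literature.AlgebraicGeometry.Resolution
open Literature.AlgebraicGeometry.Resolution.Hauser2010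
open Literature.AlgebraicGeometry.Resolution.AffinePointBlowup (P A γ coord Wtop ξ)

namespace Equimultiple

section DefsAT

variable {K : Type} [Field K] (p : ℕ) [DecidableEq K] {X' : Scheme.{0}}

/-- **The tranche-1 datum of an ATLAS MEMBER `c`** with reading set `R`: basics per reading (`s.F ≠ 0` clean, `T` permissible) · the
FORMAT INVARIANT per reading (deferred indices are bundle directions; bundle directions are not centre variables) · `c` regular and snc
with the boundary · `MemberAtlasZF` (zigzag per reading, dictionary, fibre pieces closed, cover by owned parts, disjointness) · `BlockA` at
every reading reachable along `AEdge` from a reading of `R` · `Acc` of the flipped edge relation at every reading of `R`. (= `MemberDataAF`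
minus its last clause, plus the format invariant.) [cite: BierstoneGrigorievMilmanWlodarczyk2011, Def. 3.1.3] [cite: Hauser2010, §§F–G] -/
def MemberDataAT [IsAlgClosed K] [CharP K p] [Fact p.Prime]
    (plan : AReading K → Finset (Fin 4 × (Fin 4 → K) × Finset (Fin 4)))
    (leaves : AReading K → Finset (Fin 4 × (Fin 4 → K)))
    (M' : MarkedIdeal X') (c : Closeds X') (R : Finset (AReading K)) : Prop :=
  (∀ r ∈ R, r.1.F ≠ 0 ∧ Literature.Barriers.ResolutionOfSingularities.HauserPerlega.IsClean p r.1.F ∧ IsPermissibleCentre p r.2.1 r.1.F) ∧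
  (∀ r ∈ R, (∀ iv ∈ r.2.2.1, iv.1 ∈ r.2.2.2) ∧ ∀ m ∈ r.2.2.2, m ∉ r.2.1) ∧
  Scheme.IsRegular (vanishingIdeal c).subscheme ∧ HasSNCWith M'.boundary (vanishingIdeal c) ∧
  MemberAtlasZF p M' c R ∧
  (∀ r ∈ R, ∀ q : AReading K,
    Relation.ReflTransGen (fun a b : AReading K => AEdge p plan b a) r q → BlockA p plan leaves q) ∧
  (∀ r ∈ R, Acc (fun q' q : AReading K => AEdge p plan q' q) r)

end DefsAT

end Equimultiple

end Summit.ResolutionOfSingularities.ResolutionOfSingularities.Theorems.PIDim4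

end
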